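import Mathlib
import HarnessLib
import Literature.MathematicalPhysics.QuantumLattice.GrassmannEffectiveActionGradedDB
import Literature.MathematicalPhysics.QuantumLattice.HubbardSectorGridOverlap
import Literature.MathematicalPhysics.QuantumLattice.HubbardGridCounterQuadratic
import Literature.MathematicalPhysics.QuantumLattice.HubbardGridInteractionKernels
import Summits.HubbardSuperconductivity.HubbardSuperconductivity.Theorems.KLProgrammeKLRegimeFrameShellCount
import Summits.HubbardSuperconductivity.HubbardSuperconductivity.Theorems.KLProgrammeKLRegimeSplitEngineV4

/-!
# K3 engine child (stmt-HubbardSuperconductivity-19823), stub `stub_engine_scale0`, clause (E1-v4)₀: the scale-`0`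
# sectorised kernel norms from ONE degree-graded determinant-bounded Gaussian step on the `4M` time grid

Cell gate-hubbard-kl, seat hubbard-kl-k3c2-p1 (row «scale-0 Gram step `stub_engine_scale0`, `κ² ≍ (1/π) log M`»).

`KernelNormsV4 L M P Q β U μ K 0` asks, for every `p ≥ 2`,
`klAnisoLegKernelNorm L M β U μ K klE0 0 (2p) ≤ Q.CE^p · (epsCoupling P U 0)^{p-1}`: the anisotropic-sector `L¹–L^∞`
norm of the `2p`-leg kernels of the scale-`0` effective action `𝒱^{(0)} = effAction C^K_{>e₀} (V + 𝒩_K)` must be of ORDER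
`p - 1` in `U`, uniformly in `β ≥ klBetaMin`, `L`, `M`.  This file assembles that bound from tree theorems, leaving exactly
THREE analytic sizes as hypotheses (each the subject of a sibling seat's file):

1. the interaction is pulled back to the `4M`-point time grid (`HubbardGridFieldSubstitution.map_hubbardGridSub_gridInteraction`,
   p5; `HubbardGridCounterQuadratic.map_hubbardGridSub_gridCounterQuadratic`, p3 g5): `V + 𝒩_K = map S (V_N + 𝒩_{K,N})`,
   `N = 4M`, with pinned kernel norms `≤ |U|β/N` (degree 4) and `≤ (β/N)·coeffNorm 0 K` (degree 2);
2. the Gaussian step is run in the grid fields with the pulled-back covariance `Sᵀ C^K_{>e₀} S`, replica-Gram-bounded with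
   the `M`-, `β`-uniform constant of `isGramBoundedR_scaleZero_of_frameOK_sharp` (Pedra–Salmhofer determinant bound on the grid,
   k3c2-p1 / k3c4-p1) — HYPOTHESIS (α): its row/column sums `Σ_Y ‖(SᵀCS) X Y‖ ≤ α` (the decay constant, k3c4-p2);
3. the output is read through the sector analysis map `E₀ = sectorAnalysisMatrix β (klAnisoFamily … 0)`
   (`HubbardSectorFieldSubstitution.hubbardSectorKernelNorm_le_kernelNorm_map`), and the DEGREE-GRADED representation theorem
   `GrassmannEffectiveActionGradedDB.kernelNorm_kernel_map_effAction_le_pow_of_gramBounded_quartic` (k3c2-p1) gives the factor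
   `θ^{p-2}` — HYPOTHESES (Br), (Bc): the row/column sizes of the cross-grid overlap kernel `E₀ S`
   (`HubbardSectorGridOverlap.rowSum_/colSum_sectorAnalysis_mul_gridSub_le`, k3c2-p1: one scale-`0` multiplier kernel's `ℓ¹`
   sizes on the two grids — the "sector lemma" at scale `0`).

* `hubbardGridCounterQuadratic_mem_evenPart`, `sum_norm_kernel_gridVertex_le`, `kernel_gridVertex_of_two_lt` — the grid vertex
  `V_N + 𝒩_{K,N}` is even, has no constant part, pinned norms (profile `N(1) = (β/N)·coeffNorm 0 K`, `N(2) = |U|β/N`), degree `≤ 4`; `normV_scaleZeroPinned_eq` (its `‖·‖_h` in closed form);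
* `klEffectiveAction_zero_eq_effAction_map` — `𝒱^{(0)} = effAction C^K_{>e₀} (map S (V_N + 𝒩_{K,N}))`;
* **`klAnisoLegKernelNorm_zero_le_of_gridStep`** — for `p ≥ 2`:
  `klAnisoLegKernelNorm … 0 (2p) ≤ Br · Bc^{2p-1} · ε_x^{2p-1} · (ρ^{-2p} · e‖Ṽ‖_h · θ^{p-2}/(1-θ))`, `ε_x = β/(2M)`,
  `‖Ṽ‖_h = normV … κ ρ (pinned norms)`, `θ = eα‖Ṽ‖_h/κ²`, for ANY Gram constant `κ`, decay constant `α`, weight `ρ`;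
* **`klAnisoLegKernelNorm_zero_le_of_frameOK`** — the same at the tree's Gram constant `κ₀ = √(2(7+6047))` for every admissible
  frame (`FrameOK R U N μ K`, `klBetaMin ≤ β ≤ L`), weight `ρ = κ₀` (with this choice `κ₀` cancels order by order:
  `ρ^{-2p}κ₀⁴(κ₀⁴/κ₀²)^{p-2} = const^p`, see `GrassmannEffectiveActionGradedDB`).

What remains for (E1-v4)₀ after this file: the three sizes (α) [k3c4-p2], (Br)/(Bc) [k3c2-p1, via k3c4-p2's weighted grid
Plancherel and the second differences of the scale-`0` multiplier on a frame] with `α·β/N`, `Br·β/N`, `Bc·β/M` ABSOLUTE constants,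
and the comparison of the resulting per-order constant with `Q.CE` (sizing [float] j261481/j261711: the tree's step constants
`16·e⁹` per order make the per-order constant `≈ 2^30–2^34`, above `klEngQ2.CE = 2^20·Psq²·Rsq²` — a package-level (∃Q witness)
adjustment is expected; recorded on the cell bus, not asserted here).

Everything is proved; no definitions, no named facts, no sorry.
-/

noncomputable section

namespace Summit.HubbardSuperconductivity.HubbardSuperconductivity.Theorems.EngineV8

set_option linter.dupNamespace false -- summit = problem name (single-conjunct summit), D-0017

open Real Finset Literature.MathematicalPhysics.QuantumLattice Literature.Probability.LatticeModels
open Literature.MathematicalPhysics.QuantumLattice.GrassmannAlgebra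
open Summit.HubbardSuperconductivity.HubbardSuperconductivity.Theorems.KLRegimeSplit
open Summit.HubbardSuperconductivity.HubbardSuperconductivity.Theorems.DispersionFlow
open Summit.HubbardSuperconductivity.HubbardSuperconductivity.Theorems.KLProgrammeLegKernels

variable {L M : ℕ} [NeZero L]

/-! ## §1 The grid vertex `V_N + 𝒩_{K,N}`: even, no constant part, pinned norms, degree `≤ 4` -/

/-- The grid counterterm is even (a combination of degree-`2` monomials). -/
theorem hubbardGridCounterQuadratic_mem_evenPart {Ng : ℕ} (β : ℝ) (K : TrigPolyC4v) :
    hubbardGridCounterQuadratic L Ng β K ∈ evenPart ℂ (GridLeg (GridPoint L Ng)) := by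
  rw [hubbardGridCounterQuadratic_eq_sum, mem_evenPart_iff]
  refine Submodule.sum_mem _ fun i _ => Submodule.smul_mem _ _ ?_
  exact CliffordAlgebra.ι_mul_ι_mem_evenOdd_zero _ _ _

/-- The pinned-norm profile of the grid vertex — `(β/N)·coeffNorm 0 K` in degree `2` (`m' = 1`), `|U|·β/N` in degree `4`
(`m' = 2`), `0` otherwise (the `N(m')` of the single-scale step) — is nonnegative. -/
theorem scaleZeroPinned_nonneg (β U : ℝ) (K : TrigPolyC4v) (Ng m' : ℕ) :
    0 ≤ (if m' = 1 then |β| / Ng * K.coeffNorm 0 else if m' = 2 then |U| * |β| / Ng else 0 : ℝ) := by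
  have hc : 0 ≤ K.coeffNorm 0 := TrigPolyC4v.coeffNorm_nonneg 0 K
  split_ifs <;> positivity

/-- **The field-weighted norm of the profile in closed form**: `‖Ṽ‖_h = (e²(κ+ρ))²·(β/N)·coeffNorm 0 K + (e²(κ+ρ))⁴·|U|β/N`
(the label set has at least four elements, so both degrees are carried). -/
theorem normV_scaleZeroPinned_eq {Γ : Type*} [Fintype Γ] (hΓ : 4 ≤ Fintype.card Γ) (κ ρ β U : ℝ) (K : TrigPolyC4v) (Ng : ℕ) :
    normV Γ κ ρ (fun m' => if m' = 1 then |β| / Ng * K.coeffNorm 0 else if m' = 2 then |U| * |β| / Ng else 0) =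
      (Real.exp 2 * (κ + ρ)) ^ 2 * (|β| / Ng * K.coeffNorm 0) + (Real.exp 2 * (κ + ρ)) ^ 4 * (|U| * |β| / Ng) := by
  rw [normV, Finset.sum_eq_add (a := 1) (b := 2) (by norm_num)]
  · simp
  · intro c _ hc
    rw [if_neg hc.1, if_neg hc.2, mul_zero]
  · intro h1
    exact absurd (Finset.mem_range.2 (by omega)) h1
  · intro h2
    exact absurd (Finset.mem_range.2 (by omega)) h2

/-- The grid label set `((N-grid point, spin), charge)` has at least four elements (`N, L ≥ 1`), so `normV_scaleZeroPinned_eq`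
applies to it. -/
theorem four_le_card_gridLeg {Ng : ℕ} [NeZero Ng] : 4 ≤ Fintype.card (GridLeg (GridPoint L Ng)) := by
  have hNg : 1 ≤ Ng := Nat.one_le_iff_ne_zero.2 (NeZero.ne Ng)
  have hL : 1 ≤ L := Nat.one_le_iff_ne_zero.2 (NeZero.ne L)
  simp only [Fintype.card_prod, Fintype.card_fin, ZMod.card, Fintype.card_pi, Finset.prod_const, Finset.card_univ]
  nlinarith [Nat.one_le_pow 2 L hL]

/-- **Pinned kernel norms of the grid vertex**: `Σ_{Y : Y j = w} ‖kernel (V_N + 𝒩_{K,N}) (2m') Y‖ ≤ N(m')`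
(p5's `sum_norm_kernel_hubbardGridInteraction_le`, p3's `sum_norm_kernel_hubbardGridCounterQuadratic_le`, and the vanishing of
the other degrees). -/
theorem sum_norm_kernel_gridVertex_le {Ng : ℕ} (β U : ℝ) (K : TrigPolyC4v) (m' : ℕ) (j : Fin (2 * m'))
    (w : GridLeg (GridPoint L Ng)) :
    ∑ Y ∈ univ.filter (fun Y : Fin (2 * m') → GridLeg (GridPoint L Ng) => Y j = w),
        ‖kernel ℂ (hubbardGridInteraction L Ng β U + hubbardGridCounterQuadratic L Ng β K) (2 * m') Y‖ ≤
      (if m' = 1 then |β| / Ng * K.coeffNorm 0 else if m' = 2 then |U| * |β| / Ng else 0 : ℝ) := by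
  rcases m' with _ | _ | _ | m'
  · exact absurd j.2 (by omega)
  · -- degree 2: only the counterterm
    have h : ∀ Y : Fin (2 * 1) → GridLeg (GridPoint L Ng),
        kernel ℂ (hubbardGridInteraction L Ng β U + hubbardGridCounterQuadratic L Ng β K) (2 * 1) Y =
          kernel ℂ (hubbardGridCounterQuadratic L Ng β K) 2 Y := fun Y => by
      rw [kernel_add, kernel_hubbardGridInteraction_of_ne β U (by norm_num) Y, zero_add]
    simp only [h, if_true]
    exact sum_norm_kernel_hubbardGridCounterQuadratic_le β K j w
  · -- degree 4: only the quartic vertex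
    have h : ∀ Y : Fin (2 * 2) → GridLeg (GridPoint L Ng),
        kernel ℂ (hubbardGridInteraction L Ng β U + hubbardGridCounterQuadratic L Ng β K) (2 * 2) Y =
          kernel ℂ (hubbardGridInteraction L Ng β U) 4 Y := fun Y => by
      rw [kernel_add, kernel_hubbardGridCounterQuadratic_of_ne β K (by norm_num) Y, add_zero]
    simp only [h, show (1 + 1 : ℕ) = 2 from rfl, if_true, show (2 : ℕ) ≠ 1 by norm_num, if_false]
    exact sum_norm_kernel_hubbardGridInteraction_le β U j w
  · -- degrees `≥ 6` vanish
    have h6 : 2 * (m' + 3) ≠ 4 := by omega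
    have h6' : 2 * (m' + 3) ≠ 2 := by omega
    refine le_of_eq_of_le (sum_eq_zero fun Y _ => ?_) (scaleZeroPinned_nonneg β U K Ng _)
    rw [kernel_add, kernel_hubbardGridInteraction_of_ne β U h6 Y, kernel_hubbardGridCounterQuadratic_of_ne β K h6' Y,
      add_zero, norm_zero]

/-- The grid vertex has no kernels of degree `2m' > 4`. -/
theorem kernel_gridVertex_of_two_lt {Ng : ℕ} (β U : ℝ) (K : TrigPolyC4v) (m' : ℕ) (hm' : 2 < m')
    (Y : Fin (2 * m') → GridLeg (GridPoint L Ng)) :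
    kernel ℂ (hubbardGridInteraction L Ng β U + hubbardGridCounterQuadratic L Ng β K) (2 * m') Y = 0 := by
  rw [kernel_add, kernel_hubbardGridInteraction_of_ne β U (by omega) Y, kernel_hubbardGridCounterQuadratic_of_ne β K (by omega) Y,
    add_zero]

/-! ## §2 The scale-`0` action as a Gaussian step of the substituted grid vertex -/

/-- **`𝒱^{(0)} = effAction C^K_{>e₀} (map S (V_N + 𝒩_{K,N}))`** on the `N = 4M` time grid (`β ≠ 0`): the scale-`0` effective action of
D1 is the Wilsonian effective action of the countertermed interaction, and the latter is the image of the grid vertex under the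
grid substitution (p5's quartic half, p3's counterterm half). -/
theorem klEffectiveAction_zero_eq_effAction_map [NeZero M] {β : ℝ} (hβ : β ≠ 0) (U μ : ℝ) (K : TrigPolyC4v) :
    klEffectiveAction L M β U μ K klE0 0 =
      effAction ℂ (hubbardCovAboveCT L M β μ 0 K klE0)
        (ExteriorAlgebra.map (Matrix.toLin' (hubbardGridSub L M β (2 * (2 * M))))
          (hubbardGridInteraction L (2 * (2 * M)) β U + hubbardGridCounterQuadratic L (2 * (2 * M)) β K)) := by
  haveI : NeZero (2 * (2 * M)) := ⟨by have := NeZero.ne M; omega⟩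
  rw [klEffectiveAction, hubbardEffectiveActionCT, hubbardInteractionCT, map_add,
    map_hubbardGridSub_gridInteraction hβ U (by omega), map_hubbardGridSub_gridCounterQuadratic hβ K (by omega)]
  simp [klScale]

/-! ## §3 The sectorised norm through the analysis map, any positive degree -/

/-- `hubbardSectorKernelNorm β F A W ≤ kernelNorm ε_x m (kernel (map (toLin' E_F) W) m)` in every positive degree `m` (the tree's
`hubbardSectorKernelNorm_le_kernelNorm_map`, degree written as `m` rather than `m + 1`). -/
theorem hubbardSectorKernelNorm_le_kernelNorm_map_of_pos {Ns : ℕ} {β : ℝ} (hβ : 0 ≤ β) (F : Fin Ns → FreqMomentum L M → ℂ)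
    {m : ℕ} (hm : 0 < m) (A : Finset (Fin m → SectorLeg Ns)) (W : HubbardGrassmann L M) :
    hubbardSectorKernelNorm L M β F A W ≤
      kernelNorm (imagTimeWeight β M) m
        (kernel ℂ (ExteriorAlgebra.map (Matrix.toLin' (sectorAnalysisMatrix L M β F)) W) m) := by
  obtain ⟨q, rfl⟩ : ∃ q, m = q + 1 := ⟨m - 1, by omega⟩
  exact hubbardSectorKernelNorm_le_kernelNorm_map hβ F A W

/-! ## §4 The assembly: (E1-v4)₀'s norm from the graded determinant-bounded step -/

/-- **The scale-`0` anisotropic-sector kernel norms from ONE degree-graded determinant-bounded step** (stub `stub_engine_scale0`,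
clause (E1-v4)₀, modulo the three sizes α, Br, Bc).  Let `S = hubbardGridSub L M β (4M)`, `C₀ = C^K_{>e₀} = hubbardCovAboveCT … 0 K klE0`,
`E₀ = sectorAnalysisMatrix β (klAnisoFamily … klE0 0)`.  If `SᵀC₀S` is replica-Gram-bounded with constant `κ > 0` and has row and
column sums `≤ α`, if `θ = eα‖Ṽ‖_h/κ² < 1` for the grid vertex's pinned profile and a weight `ρ > 0`, and if the
cross-grid overlap kernel `E₀S` has row sizes `≤ Br` and column sizes `≤ Bc`, then for every `p ≥ 2`
`klAnisoLegKernelNorm … klE0 0 (2p) ≤ Br · Bc^{2p-1} · (β/(2M))^{2p-1} · (ρ^{-2p} · e‖Ṽ‖_h · θ^{p-2}/(1 - θ))`. -/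
theorem klAnisoLegKernelNorm_zero_le_of_gridStep [NeZero M] {β : ℝ} (hβ : 0 < β) (U μ : ℝ) (K : TrigPolyC4v)
    {κ : ℝ} (hκ : 0 < κ)
    (hGB : IsGramBoundedR ((hubbardGridSub L M β (2 * (2 * M))).transpose * hubbardCovAboveCT L M β μ 0 K klE0 *
      hubbardGridSub L M β (2 * (2 * M))) κ)
    {α : ℝ} (hα : 0 < α)
    (hrow : ∀ X, ∑ Y, ‖((hubbardGridSub L M β (2 * (2 * M))).transpose * hubbardCovAboveCT L M β μ 0 K klE0 *
      hubbardGridSub L M β (2 * (2 * M))) X Y‖ ≤ α)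
    (hcol : ∀ Y, ∑ X, ‖((hubbardGridSub L M β (2 * (2 * M))).transpose * hubbardCovAboveCT L M β μ 0 K klE0 *
      hubbardGridSub L M β (2 * (2 * M))) X Y‖ ≤ α)
    {ρ : ℝ} (hρ : 0 < ρ)
    (hθ : Real.exp 1 * α * normV (GridLeg (GridPoint L (2 * (2 * M)))) κ ρ ((fun m' : ℕ => if m' = 1 then |β| / (2 * (2 * M) : ℕ) * K.coeffNorm 0 else if m' = 2 then |U| * |β| / (2 * (2 * M) : ℕ) else 0)) / κ ^ 2 < 1)
    {Br Bc : ℝ} (hBr0 : 0 ≤ Br) (hBc0 : 0 ≤ Bc)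
    (hBr : ∀ (ω : Fin (sectorCount 0)) (σ c : Fin 2) (y : SpaceTimeIdx L M),
      ∑ q : GridPoint L (2 * (2 * M)),
        ‖(sectorAnalysisMatrix L M β (klAnisoFamily L M β μ K klE0 0) * hubbardGridSub L M β (2 * (2 * M)))
          (y, ((ω, σ), c)) ((q, σ), c)‖ ≤ Br)
    (hBc : ∀ (σ c : Fin 2) (q : GridPoint L (2 * (2 * M))),
      ∑ ω : Fin (sectorCount 0), ∑ y : SpaceTimeIdx L M,
        ‖(sectorAnalysisMatrix L M β (klAnisoFamily L M β μ K klE0 0) * hubbardGridSub L M β (2 * (2 * M)))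
          (y, ((ω, σ), c)) ((q, σ), c)‖ ≤ Bc)
    {p : ℕ} (hp : 2 ≤ p) :
    klAnisoLegKernelNorm L M β U μ K klE0 0 (2 * p) ≤
      Br * Bc ^ (2 * p - 1) * imagTimeWeight β M ^ (2 * p - 1) *
        (ρ⁻¹ ^ (2 * p) * (Real.exp 1 * normV (GridLeg (GridPoint L (2 * (2 * M)))) κ ρ ((fun m' : ℕ => if m' = 1 then |β| / (2 * (2 * M) : ℕ) * K.coeffNorm 0 else if m' = 2 then |U| * |β| / (2 * (2 * M) : ℕ) else 0))) *
          (Real.exp 1 * α * normV (GridLeg (GridPoint L (2 * (2 * M)))) κ ρ ((fun m' : ℕ => if m' = 1 then |β| / (2 * (2 * M) : ℕ) * K.coeffNorm 0 else if m' = 2 then |U| * |β| / (2 * (2 * M) : ℕ) else 0)) / κ ^ 2) ^ (p - 2) /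
          (1 - Real.exp 1 * α * normV (GridLeg (GridPoint L (2 * (2 * M)))) κ ρ ((fun m' : ℕ => if m' = 1 then |β| / (2 * (2 * M) : ℕ) * K.coeffNorm 0 else if m' = 2 then |U| * |β| / (2 * (2 * M) : ℕ) else 0)) / κ ^ 2)) := by
  -- notation
  set Ng : ℕ := 2 * (2 * M) with hNg
  set S := hubbardGridSub L M β Ng with hS
  set C₀ := hubbardCovAboveCT L M β μ 0 K klE0 with hC₀
  set F₀ := klAnisoFamily L M β μ K klE0 0 with hF₀
  set E₀ := sectorAnalysisMatrix L M β F₀ with hE₀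
  set Vt := hubbardGridInteraction L Ng β U + hubbardGridCounterQuadratic L Ng β K with hVt
  have hp0 : 0 < 2 * p := by omega
  have hfS : LinearMap.toMatrix' (Matrix.toLin' S) = S := LinearMap.toMatrix'_toLin' S
  have hgE : LinearMap.toMatrix' (Matrix.toLin' E₀) = E₀ := LinearMap.toMatrix'_toLin' E₀
  -- (1) the sectorised norm of `𝒱^{(0)}` through the analysis map
  have h1 : klAnisoLegKernelNorm L M β U μ K klE0 0 (2 * p) ≤
      kernelNorm (imagTimeWeight β M) (2 * p)
        (kernel ℂ (ExteriorAlgebra.map (Matrix.toLin' E₀)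
          (effAction ℂ C₀ (ExteriorAlgebra.map (Matrix.toLin' S) Vt))) (2 * p)) := by
    rw [klAnisoLegKernelNorm, klEffectiveAction_zero_eq_effAction_map hβ.ne' U μ K]
    exact hubbardSectorKernelNorm_le_kernelNorm_map_of_pos hβ.le F₀ hp0 _ _
  -- (2) the graded representation theorem
  have hVt_even : Vt ∈ evenPart ℂ (GridLeg (GridPoint L Ng)) :=
    add_mem (hubbardGridInteraction_mem_evenPart β U) (hubbardGridCounterQuadratic_mem_evenPart β K)
  have hVt0 : constPart ℂ Vt = 0 := by
    rw [hVt, map_add, constPart_hubbardGridInteraction, constPart_hubbardGridCounterQuadratic, add_zero]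
  have h2 := (kernelNorm_kernel_map_effAction_le_pow_of_gramBounded_quartic C₀ (Matrix.toLin' S) (Matrix.toLin' E₀) Vt hVt_even
    hVt0 (fun m' : ℕ => if m' = 1 then |β| / Ng * K.coeffNorm 0 else if m' = 2 then |U| * |β| / Ng else 0) (scaleZeroPinned_nonneg β U K Ng) (sum_norm_kernel_gridVertex_le β U K)
    (kernel_gridVertex_of_two_lt β U K) hκ (by rw [hfS]; exact hGB) hα (by rw [hfS]; exact hrow) (by rw [hfS]; exact hcol) hρ hθ
    hBr0 hBc0 (fun X'' => by rw [hfS, hgE]; exact rowSum_sectorAnalysis_mul_gridSub_le β F₀ _ _ hBr X'')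
    (fun X' => by rw [hfS, hgE]; exact colSum_sectorAnalysis_mul_gridSub_le β F₀ _ _ hBc X')
    (imagTimeWeight_nonneg hβ.le M) hp).2
  exact h1.trans h2

/-- **(E1-v4)₀ for every admissible frame, modulo the three sizes**: at the tree's `M`-, `β`-uniform scale-`0` Gram constant
`κ₀ = √(2(7+6047))` (`isGramBoundedR_scaleZero_of_frameOK_sharp`, `FrameOK R U N μ K`, `klBetaMin ≤ β ≤ L`) and weight `ρ = κ₀`,
for every `p ≥ 2`: `klAnisoLegKernelNorm … klE0 0 (2p) ≤ Br · Bc^{2p-1} · (β/(2M))^{2p-1} · (κ₀^{-2p} e‖Ṽ‖_h θ^{p-2}/(1-θ))`,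
`θ = eα‖Ṽ‖_h/κ₀²`. -/
theorem klAnisoLegKernelNorm_zero_le_of_frameOK [NeZero M] {R : RenConsts} {U : ℝ} {N : ℕ} {μ : ℝ} {K : TrigPolyC4v}
    (hK : FrameOK R U N μ K) {β : ℝ} (hβ : klBetaMin ≤ β) (hβL : β ≤ L)
    {α : ℝ} (hα : 0 < α)
    (hrow : ∀ X, ∑ Y, ‖((hubbardGridSub L M β (2 * (2 * M))).transpose * hubbardCovAboveCT L M β μ 0 K klE0 *
      hubbardGridSub L M β (2 * (2 * M))) X Y‖ ≤ α)
    (hcol : ∀ Y, ∑ X, ‖((hubbardGridSub L M β (2 * (2 * M))).transpose * hubbardCovAboveCT L M β μ 0 K klE0 *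
      hubbardGridSub L M β (2 * (2 * M))) X Y‖ ≤ α)
    (hθ : Real.exp 1 * α * normV (GridLeg (GridPoint L (2 * (2 * M)))) (Real.sqrt (2 * (7 + 6047))) (Real.sqrt (2 * (7 + 6047)))
      ((fun m' : ℕ => if m' = 1 then |β| / (2 * (2 * M) : ℕ) * K.coeffNorm 0 else if m' = 2 then |U| * |β| / (2 * (2 * M) : ℕ) else 0)) / Real.sqrt (2 * (7 + 6047)) ^ 2 < 1)
    {Br Bc : ℝ} (hBr0 : 0 ≤ Br) (hBc0 : 0 ≤ Bc)
    (hBr : ∀ (ω : Fin (sectorCount 0)) (σ c : Fin 2) (y : SpaceTimeIdx L M),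
      ∑ q : GridPoint L (2 * (2 * M)),
        ‖(sectorAnalysisMatrix L M β (klAnisoFamily L M β μ K klE0 0) * hubbardGridSub L M β (2 * (2 * M)))
          (y, ((ω, σ), c)) ((q, σ), c)‖ ≤ Br)
    (hBc : ∀ (σ c : Fin 2) (q : GridPoint L (2 * (2 * M))),
      ∑ ω : Fin (sectorCount 0), ∑ y : SpaceTimeIdx L M,
        ‖(sectorAnalysisMatrix L M β (klAnisoFamily L M β μ K klE0 0) * hubbardGridSub L M β (2 * (2 * M)))
          (y, ((ω, σ), c)) ((q, σ), c)‖ ≤ Bc)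
    {p : ℕ} (hp : 2 ≤ p) :
    klAnisoLegKernelNorm L M β U μ K klE0 0 (2 * p) ≤
      Br * Bc ^ (2 * p - 1) * imagTimeWeight β M ^ (2 * p - 1) *
        ((Real.sqrt (2 * (7 + 6047)))⁻¹ ^ (2 * p) *
          (Real.exp 1 * normV (GridLeg (GridPoint L (2 * (2 * M)))) (Real.sqrt (2 * (7 + 6047))) (Real.sqrt (2 * (7 + 6047)))
            ((fun m' : ℕ => if m' = 1 then |β| / (2 * (2 * M) : ℕ) * K.coeffNorm 0 else if m' = 2 then |U| * |β| / (2 * (2 * M) : ℕ) else 0))) *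
          (Real.exp 1 * α * normV (GridLeg (GridPoint L (2 * (2 * M)))) (Real.sqrt (2 * (7 + 6047))) (Real.sqrt (2 * (7 + 6047)))
            ((fun m' : ℕ => if m' = 1 then |β| / (2 * (2 * M) : ℕ) * K.coeffNorm 0 else if m' = 2 then |U| * |β| / (2 * (2 * M) : ℕ) else 0)) / Real.sqrt (2 * (7 + 6047)) ^ 2) ^ (p - 2) /
          (1 - Real.exp 1 * α * normV (GridLeg (GridPoint L (2 * (2 * M)))) (Real.sqrt (2 * (7 + 6047))) (Real.sqrt (2 * (7 + 6047)))
            ((fun m' : ℕ => if m' = 1 then |β| / (2 * (2 * M) : ℕ) * K.coeffNorm 0 else if m' = 2 then |U| * |β| / (2 * (2 * M) : ℕ) else 0)) / Real.sqrt (2 * (7 + 6047)) ^ 2)) := by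
  have hβpos : 0 < β := lt_of_lt_of_le (by norm_num [klBetaMin]) hβ
  have hκ : 0 < Real.sqrt (2 * (7 + 6047)) := Real.sqrt_pos.2 (by norm_num)
  exact klAnisoLegKernelNorm_zero_le_of_gridStep hβpos U μ K hκ (isGramBoundedR_scaleZero_of_frameOK_sharp hK hβ hβL) hα hrow
    hcol hκ hθ hBr0 hBc0 hBr hBc hp

end Summit.HubbardSuperconductivity.HubbardSuperconductivity.Theorems.EngineV8

end
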